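import Mathlib.Geometry.Manifold.WhitneyEmbedding
import Mathlib.Analysis.InnerProductSpace.Projection.FiniteDimensional
import Literature.Topology.FourManifolds.DisjunctionLemma
import Literature.Topology.FourManifolds.WhitneySphereEmbedding
import HarnessLib

/-!
# The weak Whitney embedding theorem in dimension `2n + 1`

Topic `Literature/Topology/FourManifolds` (fact seat
`provefact-Literature.Topology.FourManifolds.exists-b806fed4e8`, towards the named fact
`exists_isSmoothEmbedding_isNormalFraming_of_isStablyParallelizable` (namespace
`Literature.Topology.FourManifolds`) of `PontryaginThomCollapse.lean` — Kervaire–Milnor 1963,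
p. 510: "choose an imbedding
`i : M → Sⁿ⁺ᵏ` with `k > n + 1`. Such an imbedding exists" — which asks for an embedding into the
sphere of *every* dimension `n + k`, `k > n + 1`, whereas Mathlib's Whitney embedding theorem
`exists_embedding_euclidean_of_compact` and the tree's `exists_injective_immersion_sphere`
(`WhitneySphereEmbedding.lean`) only provide *some* large dimension). **Everything here is
proved.**

We prove the **weak Whitney embedding theorem with the dimension bound**: a compact `n`-manifold
admits an injective immersion into `ℝᴺ` for every `N ≥ 2n + 1` (Whitney 1936; Hirsch,
*Differential Topology* (1976), Ch. 1 §3, Thm. 3.5; Kosinski, *Differential Manifolds* (1993),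
II (3.3)–(3.4)), by the classical projection argument started from Mathlib's embedding into some
`ℝᴺ⁰`:

* `exists_fderivWithin_comp_chartAt_symm_eq`, `contMDiffOn_fderivWithin_comp_chartAt_symm` — the
  values `df_x(w)` of the differential are values of the chart-read derivatives
  `D(f ∘ φ⁻¹)(φ x) w'`, which are `C¹` in `(x, w')` on `φ.source × ℝⁿ`;
* `dimH_setOf_mfderiv_le` (`≤ 2n`), `dimH_setOf_smul_sub_le` (`≤ 2n + 1`) — the tangent
  directions and the secant cone `{t (f x - f y)}` are small, by the trivial case of Sard's
  theorem in Hausdorff-dimension form (the tree's `dimH_image_le_finrank_of_contMDiffOn`,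
  `DisjunctionLemma.lean`; Hirsch, Ch. 3 §1, Prop. 1.2) on the manifolds `M × ℝⁿ` (countably many
  charts) and `M × M × ℝ`;
* `exists_injective_immersion_of_succ` — **the projection step**: for `2n + 1 ≤ N` a direction
  `v ∈ ℝᴺ⁺¹` off both sets and nonzero exists (`dense_compl_of_dimH_lt_finrank`), and the
  orthogonal projection onto `(ℝ v)ᗮ ≅ ℝᴺ` composed with `f` is again an injective immersion;
* `exists_injective_immersion_euclidean` — **Whitney**: for every `N ≥ 2n + 1` an injective
  `C^∞` immersion `M → ℝᴺ` (pad by zeros if Mathlib's `N₀ ≤ N`, else project `N₀ - N` times);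
* `exists_injective_immersion_sphere_of_le` — the form consumed by Kervaire–Milnor §4: for every
  `k ≥ n + 1` an injective `C^∞` immersion `M → 𝕊ⁿ⁺ᵏ` (compose with the inverse stereographic
  projection `stereoInv` of `WhitneySphereEmbedding.lean`).

## References

* H. Whitney, *Differentiable manifolds*, Ann. of Math. 37 (1936), 645–680 (the embedding in
  `ℝ²ⁿ⁺¹`; cited through Hirsch).
* M. W. Hirsch, *Differential Topology*, GTM 33, Springer (1976), Ch. 1 §3, Thm. 3.5 and its
  proof (projection along a direction off the secants and tangents), Ch. 3 §1, Prop. 1.2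
  (a `C¹` image of a lower-dimensional manifold is nowhere dense). [HirschDT1976]
* A. Kosinski, *Differential Manifolds* (1993), II (3.3)–(3.4). [Kosinski1993]
-/

open scoped Manifold ContDiff Topology
open Set Function Module

noncomputable section

namespace Literature.Topology.FourManifolds

variable {n : ℕ} {M : Type*} [TopologicalSpace M] [ChartedSpace (EuclideanSpace ℝ (Fin n)) M]
  [IsManifold (𝓡 n) ∞ M]
  {F : Type*} [NormedAddCommGroup F] [NormedSpace ℝ F]

/-- **Tangent vectors are chart-read derivatives.** For a `C¹` map `f : M → F` into a normed
space and a chart `φ = chartAt p` containing `x`, every value `df_x(w)` of the differential is a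
value of the derivative of the chart representative `f ∘ φ⁻¹` at `φ x` (the differential of
`φ⁻¹` at `φ x` being onto). [folklore] -/
theorem exists_fderivWithin_comp_chartAt_symm_eq {f : M → F}
    (hf : ContMDiff (𝓡 n) 𝓘(ℝ, F) 1 f) (p : M) {x : M}
    (hx : x ∈ (chartAt (EuclideanSpace ℝ (Fin n)) p).source) (w : EuclideanSpace ℝ (Fin n)) :
    ∃ w' : EuclideanSpace ℝ (Fin n),
      fderivWithin ℝ (f ∘ (chartAt (EuclideanSpace ℝ (Fin n)) p).symm)
        (chartAt (EuclideanSpace ℝ (Fin n)) p).target (chartAt (EuclideanSpace ℝ (Fin n)) p x) w' =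
      mfderiv (𝓡 n) 𝓘(ℝ, F) f x w := by
  set φ := chartAt (EuclideanSpace ℝ (Fin n)) p
  have hφx : φ x ∈ φ.target := φ.map_source hx
  have hd : φ.symm.MDifferentiable (𝓡 n) (𝓡 n) := (mdifferentiable_chart p).symm
  obtain ⟨w', hw'⟩ := hd.mfderiv_surjective (by simpa using hφx) w
  refine ⟨w', ?_⟩
  have hfd : MDifferentiableAt (𝓡 n) 𝓘(ℝ, F) f x := hf.mdifferentiableAt one_ne_zero
  have hsd : MDifferentiableAt (𝓡 n) (𝓡 n) φ.symm (φ x) :=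
    hd.mdifferentiableAt (by simpa using hφx)
  have key : mfderiv (𝓡 n) 𝓘(ℝ, F) (f ∘ φ.symm) (φ x) w' = mfderiv (𝓡 n) 𝓘(ℝ, F) f x w := by
    rw [mfderiv_comp_apply_of_eq (φ x) hfd hsd (φ.left_inv hx), hw']
  rw [fderivWithin_of_isOpen φ.open_target hφx, ← mfderiv_eq_fderiv]
  exact key

/-- **The chart-read bundled derivative is `C¹`.** For a `C^∞` map `f : M → F` and a chart
`φ = chartAt p`, the map `(x, w) ↦ D(f ∘ φ⁻¹)(φ x) w` is `C¹` on `φ.source × ℝⁿ` (the chart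
representative `f ∘ φ⁻¹` is `C^∞` on the open chart target). [folklore] -/
theorem contMDiffOn_fderivWithin_comp_chartAt_symm {f : M → F}
    (hf : ContMDiff (𝓡 n) 𝓘(ℝ, F) ∞ f) (p : M) :
    ContMDiffOn ((𝓡 n).prod (𝓡 n)) 𝓘(ℝ, F) 1
      (fun q : M × EuclideanSpace ℝ (Fin n) =>
        fderivWithin ℝ (f ∘ (chartAt (EuclideanSpace ℝ (Fin n)) p).symm)
          (chartAt (EuclideanSpace ℝ (Fin n)) p).target (chartAt (EuclideanSpace ℝ (Fin n)) p q.1)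
          q.2)
      ((chartAt (EuclideanSpace ℝ (Fin n)) p).source ×ˢ univ) := by
  set φ := chartAt (EuclideanSpace ℝ (Fin n)) p
  have h1 : ContMDiffOn (𝓡 n) 𝓘(ℝ, F) ∞ (f ∘ φ.symm) φ.target :=
    hf.comp_contMDiffOn contMDiffOn_chart_symm
  have h2 : ContDiffOn ℝ ∞ (f ∘ φ.symm) φ.target := contMDiffOn_iff_contDiffOn.mp h1
  have h3 : ContDiffOn ℝ 1 (fun q : EuclideanSpace ℝ (Fin n) × EuclideanSpace ℝ (Fin n) =>
      (fderivWithin ℝ (f ∘ φ.symm) φ.target q.1 : EuclideanSpace ℝ (Fin n) →L[ℝ] F) q.2)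
      (φ.target ×ˢ univ) :=
    contDiffOn_fderivWithin_apply (m := 1) h2 φ.open_target.uniqueDiffOn (by norm_cast)
  have h4 : ContMDiffOn ((𝓡 n).prod (𝓡 n))
      𝓘(ℝ, EuclideanSpace ℝ (Fin n) × EuclideanSpace ℝ (Fin n)) 1
      (fun q : M × EuclideanSpace ℝ (Fin n) => (φ q.1, q.2))
      (φ.source ×ˢ (univ : Set (EuclideanSpace ℝ (Fin n)))) := by
    refine ContMDiffOn.prodMk_space ?_ contMDiff_snd.contMDiffOn
    exact contMDiffOn_chart.comp contMDiff_fst.contMDiffOn fun q hq => hq.1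
  exact (contMDiffOn_iff_contDiffOn.mpr h3).comp h4 fun q hq => ⟨φ.map_source hq.1, mem_univ _⟩

variable [SecondCountableTopology M]

/-- **The tangent directions of a `C^∞` map from an `n`-manifold span a set of Hausdorff dimension
at most `2n`**: the set `{df_x(w)}` of all values of the differential of `f : M → F` has
`dimH ≤ 2n` (it is covered by the images of `φ.source × ℝⁿ`, `φ` running over countably many
charts, under the `C¹` maps `(x, w) ↦ D(f ∘ φ⁻¹)(φ x) w`; Hirsch, *Differential Topology*, Ch. 3
§1, Prop. 1.2, applied on the `2n`-manifold `M × ℝⁿ`). [cite: HirschDT1976, Ch. 3 §1, Prop. 1.2] -/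
theorem dimH_setOf_mfderiv_le {f : M → F} (hf : ContMDiff (𝓡 n) 𝓘(ℝ, F) ∞ f) :
    dimH {v : F | ∃ (x : M) (w : EuclideanSpace ℝ (Fin n)), mfderiv (𝓡 n) 𝓘(ℝ, F) f x w = v} ≤
      2 * n := by
  -- countably many charts cover `M`
  obtain ⟨T, hTc, hTcov⟩ := TopologicalSpace.countable_cover_nhds (α := M)
    (f := fun p => (chartAt (EuclideanSpace ℝ (Fin n)) p).source) fun p =>
      (chartAt (EuclideanSpace ℝ (Fin n)) p).open_source.mem_nhds (mem_chart_source _ p)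
  -- the pieces
  let G : M → M × EuclideanSpace ℝ (Fin n) → F := fun p q =>
    fderivWithin ℝ (f ∘ (chartAt (EuclideanSpace ℝ (Fin n)) p).symm)
      (chartAt (EuclideanSpace ℝ (Fin n)) p).target (chartAt (EuclideanSpace ℝ (Fin n)) p q.1) q.2
  have hsub : {v : F | ∃ (x : M) (w : EuclideanSpace ℝ (Fin n)), mfderiv (𝓡 n) 𝓘(ℝ, F) f x w = v} ⊆
      ⋃ p ∈ T, G p '' ((chartAt (EuclideanSpace ℝ (Fin n)) p).source ×ˢ univ) := by
    rintro v ⟨x, w, rfl⟩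
    have hx : x ∈ ⋃ p ∈ T, (chartAt (EuclideanSpace ℝ (Fin n)) p).source := by
      rw [hTcov]; exact mem_univ x
    obtain ⟨p, hp, hxp⟩ := mem_iUnion₂.mp hx
    obtain ⟨w', hw'⟩ :=
      exists_fderivWithin_comp_chartAt_symm_eq (hf.of_le (by exact_mod_cast le_top)) p hxp w
    exact mem_iUnion₂.mpr ⟨p, hp, (x, w'), ⟨hxp, mem_univ _⟩, hw'⟩
  refine (dimH_mono hsub).trans ?_
  rw [dimH_bUnion hTc]
  refine iSup₂_le fun p _ => ?_
  have := dimH_image_le_finrank_of_contMDiffOn (I := (𝓡 n).prod (𝓡 n))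
    ((chartAt (EuclideanSpace ℝ (Fin n)) p).open_source.prod isOpen_univ)
    (contMDiffOn_fderivWithin_comp_chartAt_symm hf p)
  refine this.trans ?_
  rw [finrank_prod, finrank_euclideanSpace_fin]
  norm_cast
  omega

/-- **The secant directions of a map from an `n`-manifold span a set of Hausdorff dimension at
most `2n + 1`**: the cone `{t (f x - f y)}` over the secants of a `C^∞` map `f : M → F` has
`dimH ≤ 2n + 1` (image of the `(2n+1)`-manifold `M × M × ℝ` under a `C^∞` map; Hirsch, Ch. 3 §1,
Prop. 1.2). [cite: HirschDT1976, Ch. 3 §1, Prop. 1.2] -/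
theorem dimH_setOf_smul_sub_le {f : M → F} (hf : ContMDiff (𝓡 n) 𝓘(ℝ, F) ∞ f) :
    dimH {v : F | ∃ (x y : M) (t : ℝ), t • (f x - f y) = v} ≤ 2 * n + 1 := by
  let g : (M × M) × ℝ → F := fun q => q.2 • (f q.1.1 - f q.1.2)
  have hg : ContMDiff (((𝓡 n).prod (𝓡 n)).prod 𝓘(ℝ, ℝ)) 𝓘(ℝ, F) 1 g := by
    refine contMDiff_snd.smul ?_
    exact ((hf.of_le (by exact_mod_cast le_top)).comp (contMDiff_fst.comp contMDiff_fst)).sub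
      ((hf.of_le (by exact_mod_cast le_top)).comp (contMDiff_snd.comp contMDiff_fst))
  have hsub : {v : F | ∃ (x y : M) (t : ℝ), t • (f x - f y) = v} ⊆ range g := by
    rintro v ⟨x, y, t, rfl⟩
    exact ⟨((x, y), t), rfl⟩
  refine (dimH_mono hsub).trans ((dimH_range_le_finrank_of_contMDiff hg).trans ?_)
  rw [finrank_prod, finrank_prod, finrank_euclideanSpace_fin, Module.finrank_self]
  norm_cast
  omega

/-- **The projection step of the weak Whitney embedding theorem** (Hirsch, *Differential
Topology* (1976), Ch. 1 §3, Thm. 3.5 with Ch. 3 §1, Prop. 1.2; Kosinski, *Differential Manifolds*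
(1993), II (3.3)–(3.4)): an injective `C^∞` immersion `f : M → ℝᴺ⁺¹` of a compact `n`-manifold,
`2n + 1 ≤ N`, projects along a suitable direction `v` to an injective immersion `M → ℝᴺ`. The
direction is chosen off the secant cone `{t (f x - f y)}` (`dimH ≤ 2n + 1`), off the tangent
directions `{df_x(w)}` (`dimH ≤ 2n`) and nonzero — possible because a set of Hausdorff dimension
`< N + 1` has dense complement —, and the projection is the orthogonal projection onto `(ℝ v)ᗮ`
followed by a linear isomorphism `(ℝ v)ᗮ ≅ ℝᴺ`.
[cite: HirschDT1976, Ch. 1 §3 Thm. 3.5 and Ch. 3 §1 Prop. 1.2] -/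
theorem exists_injective_immersion_of_succ {N : ℕ} (hN : 2 * n + 1 ≤ N)
    {f : M → EuclideanSpace ℝ (Fin (N + 1))} (hf : ContMDiff (𝓡 n) (𝓡 (N + 1)) ∞ f)
    (hinj : Injective f) (hf' : ∀ x, Injective (mfderiv (𝓡 n) (𝓡 (N + 1)) f x)) :
    ∃ g : M → EuclideanSpace ℝ (Fin N), ContMDiff (𝓡 n) (𝓡 N) ∞ g ∧ Injective g ∧
      ∀ x, Injective (mfderiv (𝓡 n) (𝓡 N) g x) := by
  -- a direction `v` off the secant cone, off the tangent directions, and nonzero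
  set B₁ := {v : EuclideanSpace ℝ (Fin (N + 1)) | ∃ (x y : M) (t : ℝ), t • (f x - f y) = v} with hB₁
  set B₂ := {v : EuclideanSpace ℝ (Fin (N + 1)) |
    ∃ (x : M) (w : EuclideanSpace ℝ (Fin n)), mfderiv (𝓡 n) (𝓡 (N + 1)) f x w = v} with hB₂
  have hdim : dimH (B₁ ∪ B₂ ∪ {0}) < finrank ℝ (EuclideanSpace ℝ (Fin (N + 1))) := by
    rw [dimH_union, dimH_union, dimH_singleton, finrank_euclideanSpace_fin]
    have h1 := dimH_setOf_smul_sub_le hf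
    have h2 := dimH_setOf_mfderiv_le hf
    have h1' : (2 * n + 1 : ENNReal) < ((N + 1 : ℕ) : ENNReal) := by exact_mod_cast (by omega)
    have h2' : (2 * n : ENNReal) < ((N + 1 : ℕ) : ENNReal) := by exact_mod_cast (by omega)
    have h3' : (0 : ENNReal) < ((N + 1 : ℕ) : ENNReal) := by exact_mod_cast Nat.succ_pos N
    exact max_lt (max_lt (h1.trans_lt h1') (h2.trans_lt h2')) h3'
  obtain ⟨v, hv⟩ := (dense_compl_of_dimH_lt_finrank hdim).nonempty
  simp only [mem_compl_iff, mem_union, mem_singleton_iff, not_or] at hv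
  obtain ⟨⟨hv₁, hv₂⟩, hv0⟩ := hv
  -- the projection along `v`
  let K : Submodule ℝ (EuclideanSpace ℝ (Fin (N + 1))) := (ℝ ∙ v)ᗮ
  haveI : Fact (finrank ℝ (EuclideanSpace ℝ (Fin (N + 1))) = N + 1) :=
    ⟨finrank_euclideanSpace_fin⟩
  have hK : finrank ℝ K = N := Submodule.finrank_orthogonal_span_singleton hv0
  have hKN : finrank ℝ K = finrank ℝ (EuclideanSpace ℝ (Fin N)) := by
    rw [hK, finrank_euclideanSpace_fin]
  let e : K ≃L[ℝ] EuclideanSpace ℝ (Fin N) := ContinuousLinearEquiv.ofFinrankEq hKN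
  let L : EuclideanSpace ℝ (Fin (N + 1)) →L[ℝ] EuclideanSpace ℝ (Fin N) :=
    (e : K →L[ℝ] EuclideanSpace ℝ (Fin N)).comp K.orthogonalProjectionOnto
  have hker : ∀ w, L w = 0 → ∃ c : ℝ, c • v = w := by
    intro w hw
    have hP : K.orthogonalProjectionOnto w = 0 := by
      have h' : e (K.orthogonalProjectionOnto w) = 0 := hw
      exact e.toLinearEquiv.map_eq_zero_iff.mp h'
    rw [Submodule.orthogonalProjectionOnto_eq_zero_iff, Submodule.orthogonal_orthogonal] at hP
    exact Submodule.mem_span_singleton.mp hP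
  refine ⟨L ∘ f, L.contMDiff.comp hf, ?_, ?_⟩
  · -- injectivity: `v` is off the secant cone
    intro x y hxy
    have h0 : L (f x - f y) = 0 := by rw [map_sub, sub_eq_zero]; exact hxy
    obtain ⟨c, hc⟩ := hker _ h0
    by_cases hc0 : c = 0
    · rw [hc0, zero_smul] at hc
      exact hinj (sub_eq_zero.mp hc.symm)
    · refine absurd ⟨x, y, c⁻¹, ?_⟩ hv₁
      rw [← hc, smul_smul, inv_mul_cancel₀ hc0, one_smul]
  · -- immersion: `v` is off the tangent directions
    intro x
    refine (injective_iff_map_eq_zero _).2 fun w hw => ?_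
    rw [mfderiv_comp_apply x L.mdifferentiableAt (hf.mdifferentiableAt (by simp)),
      ContinuousLinearMap.mfderiv_eq] at hw
    obtain ⟨c, hc⟩ := hker _ hw
    by_cases hc0 : c = 0
    · rw [hc0, zero_smul] at hc
      exact (injective_iff_map_eq_zero _).1 (hf' x) w hc.symm
    · refine absurd ⟨x, c⁻¹ • w, ?_⟩ hv₂
      have h1 : mfderiv (𝓡 n) (𝓡 (N + 1)) f x (c⁻¹ • w) = c⁻¹ • mfderiv (𝓡 n) (𝓡 (N + 1)) f x w :=
        map_smul _ _ _
      have h2 : v = c⁻¹ • mfderiv (𝓡 n) (𝓡 (N + 1)) f x w := by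
        have := congrArg (fun z : EuclideanSpace ℝ (Fin (N + 1)) => c⁻¹ • z) hc
        rw [inv_smul_smul₀ hc0] at this
        exact this
      exact h1.trans h2.symm

/-- Going down: an injective immersion into `ℝᴺ⁺ᵈ` projects to one into `ℝᴺ`, `2n + 1 ≤ N`
(`d` projection steps). [cite: HirschDT1976, Ch. 1 §3 Thm. 3.5] -/
theorem exists_injective_immersion_of_add {N : ℕ} (hN : 2 * n + 1 ≤ N) (d : ℕ)
    (h : ∃ f : M → EuclideanSpace ℝ (Fin (N + d)), ContMDiff (𝓡 n) (𝓡 (N + d)) ∞ f ∧ Injective f ∧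
      ∀ x, Injective (mfderiv (𝓡 n) (𝓡 (N + d)) f x)) :
    ∃ g : M → EuclideanSpace ℝ (Fin N), ContMDiff (𝓡 n) (𝓡 N) ∞ g ∧ Injective g ∧
      ∀ x, Injective (mfderiv (𝓡 n) (𝓡 N) g x) := by
  induction d with
  | zero => exact h
  | succ d ih =>
    obtain ⟨f, hf, hinj, hf'⟩ := h
    exact ih (exists_injective_immersion_of_succ (N := N + d) (by omega) hf hinj hf')

omit [IsManifold (𝓡 n) ∞ M] [SecondCountableTopology M] in
/-- Going up: zero-padding `ℝᵃ ⊆ ℝᵇ` preserves injective immersions. [folklore] -/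
theorem exists_injective_immersion_of_le {a b : ℕ} (hab : a ≤ b)
    (h : ∃ f : M → EuclideanSpace ℝ (Fin a), ContMDiff (𝓡 n) (𝓡 a) ∞ f ∧ Injective f ∧
      ∀ x, Injective (mfderiv (𝓡 n) (𝓡 a) f x)) :
    ∃ g : M → EuclideanSpace ℝ (Fin b), ContMDiff (𝓡 n) (𝓡 b) ∞ g ∧ Injective g ∧
      ∀ x, Injective (mfderiv (𝓡 n) (𝓡 b) g x) := by
  obtain ⟨f, hf, hinj, hf'⟩ := h
  let L := euclideanPad hab
  refine ⟨L ∘ f, L.contMDiff.comp hf, (euclideanPad_injective hab).comp hinj, fun x => ?_⟩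
  refine (injective_iff_map_eq_zero _).2 fun w hw => ?_
  rw [mfderiv_comp_apply x L.mdifferentiableAt (hf.mdifferentiableAt (by simp)),
    ContinuousLinearMap.mfderiv_eq] at hw
  exact (injective_iff_map_eq_zero _).1 (hf' x) w
    ((injective_iff_map_eq_zero _).1 (euclideanPad_injective hab) _ hw)

variable [T2Space M] [CompactSpace M]

/-- **The weak Whitney embedding theorem in dimension `2n + 1`** (Whitney 1936; Hirsch,
*Differential Topology* (1976), Ch. 1 §3, Thm. 3.5: "every compact `n`-manifold embeds in
`ℝ²ⁿ⁺¹`"; Kosinski, *Differential Manifolds* (1993), II (3.4)): a compact Hausdorff `C^∞`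
manifold modelled on `ℝⁿ` admits, for every `N ≥ 2n + 1`, an injective `C^∞` map `M → ℝᴺ` with
injective differential at every point (an injective immersion, hence — `M` being compact — an
embedding). Proof: Mathlib's `exists_embedding_euclidean_of_compact` gives such a map into some
`ℝᴺ⁰`; if `N₀ ≤ N` pad by zeros, otherwise project `N₀ - N` times
(`exists_injective_immersion_of_succ`). [cite: HirschDT1976, Ch. 1 §3 Thm. 3.5] -/
theorem exists_injective_immersion_euclidean {N : ℕ} (hN : 2 * n + 1 ≤ N) :
    ∃ f : M → EuclideanSpace ℝ (Fin N), ContMDiff (𝓡 n) (𝓡 N) ∞ f ∧ Injective f ∧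
      ∀ x, Injective (mfderiv (𝓡 n) (𝓡 N) f x) := by
  obtain ⟨N₀, e, he, hemb, he'⟩ := exists_embedding_euclidean_of_compact (I := 𝓡 n) (M := M)
  rcases le_or_gt N₀ N with h | h
  · exact exists_injective_immersion_of_le h ⟨e, he, hemb.injective, he'⟩
  · obtain ⟨d, rfl⟩ : ∃ d, N₀ = N + d := ⟨N₀ - N, by omega⟩
    exact exists_injective_immersion_of_add hN d ⟨e, he, hemb.injective, he'⟩

/-- **A compact `n`-manifold immerses injectively in every round sphere `𝕊ⁿ⁺ᵏ`, `k ≥ n + 1`**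
(Whitney's theorem in dimension `n + k ≥ 2n + 1` followed by the inverse stereographic
projection `ℝⁿ⁺ᵏ → 𝕊ⁿ⁺ᵏ`, an injective immersion): the embedding "`i : M → Sⁿ⁺ᵏ` with
`k > n + 1`. Such an imbedding exists" of Kervaire–Milnor 1963, p. 510, for *every* such `k`.
[cite: HirschDT1976, Ch. 1 §3 Thm. 3.5] -/
theorem exists_injective_immersion_sphere_of_le {k : ℕ} (hk : n + 1 ≤ k) :
    ∃ f : M → Metric.sphere (0 : EuclideanSpace ℝ (Fin (n + k + 1))) 1,
      ContMDiff (𝓡 n) (𝓡 (n + k)) ∞ f ∧ Injective f ∧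
        ∀ x, Injective (mfderiv (𝓡 n) (𝓡 (n + k)) f x) := by
  obtain ⟨g, hg, hinj, hg'⟩ := exists_injective_immersion_euclidean (n := n) (M := M)
    (N := n + k) (by omega)
  refine ⟨stereoInv (n + k) ∘ g, (contMDiff_stereoInv _).comp hg,
    (stereoInv_injective _).comp hinj, fun x => ?_⟩
  refine (injective_iff_map_eq_zero _).2 fun w hw => ?_
  rw [mfderiv_comp_apply x ((contMDiff_stereoInv _).mdifferentiableAt (by simp))
    (hg.mdifferentiableAt (by simp))] at hw
  exact (injective_iff_map_eq_zero _).1 (hg' x) w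
    ((injective_iff_map_eq_zero _).1 (injective_mfderiv_stereoInv _ _) _ hw)

end Literature.Topology.FourManifolds
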